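import Summits.QuantumFields.QCD.Theses.NestedDissectionSea
import Summits.QuantumFields.QCD.Theorems.NestedDissectionSeaNegativeCellsDiluteStubDefectCrossing
import Summits.QuantumFields.QCD.Theorems.NestedDissectionSeaNegativeCellsDiluteStubBoxGroundState
import Summits.QuantumFields.QCD.Theorems.NestedDissectionSeaNegativeCellsDiluteStubKineticEdgeCell
import Summits.QuantumFields.QCD.Theorems.NestedDissectionSeaNegativeCellsDiluteStubSojourn
import Summits.QuantumFields.QCD.Theorems.NestedDissectionSeaNegativeCellsDiluteStubReverseWegnerCount

/-!
# `NegativeCellsDilute` from the pinned strip law — the certified reduction of line `mass-wegner-cell-index`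
(crux `Summit.QuantumFields.QCD.Theses.NestedDissectionSea.NegativeCellsDilute`, item stmt-QuantumFields-13900,
route route-QuantumFields-NestedDissectionSea; lead prover-line-stmt-QuantumFields-13900-0, 2026-08-16)

This file records, sorry-free and over tree vocabulary only, the IMPLICATION proved by the line: the transfer
`C⁺` = (a⁺) WINDOWED STRIP LAW ∧ (b) PARITY PIN under ONE admissible regularisation implies the crux
(`negativeCellsDilute_of_pinnedStripLaw`). `C⁺` itself is open physics (a Lifshitz-tail bound for `η`-near-kernels of
mesoscopic Dirichlet Wilson cells under the phase-quenched `SU(3)` measure, plus the pin) and is NOT asserted here; it is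
the hypothesis. The deterministic and measure-theoretic content is imported from the five landed stub files:

* `stub_defectCrossing` — a sign defect forces a zero mode of the parent or a child cell at a bare mass `μ₀ ≥ μ`;
* `stub_boxGroundState`, `stub_kineticEdgeCell` — KINETIC EDGE: a zero mode of a cell of sides `s ≤ N` at `μ'` forces
  `Σ_i (1 − cos(π/s_i)) ≤ −μ'`;
* `stub_sojourn` — the kernel vector at `μ₀` is an exact eigenvector with eigenvalue `μ' − μ₀` at every `μ'`;
* `stub_reverseWegnerCount` — any event forcing such a sojourn has phase-quenched probability at most the strip
  statistic `η⁻¹ Σ_f ∫_{[m_f, η − edge(s)]} P(near_η(·, μ′)) dμ′` (Tonelli over the open near-kernel event).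

Glue proved here: `one_le_halfSides`, `edge_mono`, `near_of_eigen`, `reverseWegnerSojourn` (the planner's original
stub 1: a defect at `μ` gives a crossing `μ₀ ∈ [μ, −edge(s)]` of parent/child whose kernel vector is an `η`-near kernel
at every `μ′` within `η` of `μ₀`). Pure theorem file, no definitions, standard axioms.
-/

noncomputable section

namespace Summit.QuantumFields.QCD.Cruxes.NegativeCellsDilute.MassWegnerCellIndex

open scoped BigOperators ENNReal Classical
open MeasureTheory Filter
open Literature.MathematicalPhysics.QuantumLattice Literature.MathematicalPhysics.QuantumFieldTheory
  Literature.Probability.LatticeModels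
open Summit.QuantumFields.QCD.Theses.NestedDissectionSea (NegativeCellsDilute)

/-! ## Glue: the planner's stub 1 from the landed stubs 1a–1c -/

/-- Each child side is at least `1` when the parent sides are `≥ 2`. -/
theorem one_le_halfSides (s : Fin 4 → ℕ) (hs : ∀ i, 2 ≤ s i) (c : Fin 4 → Bool) (i : Fin 4) :
    1 ≤ halfSides s c i := by
  have h := hs i
  unfold halfSides
  split_ifs <;> omega

/-- Monotonicity of the kinetic edge in the sides: shrinking a box (to sides `≥ 1`) raises its edge,
`Σ_i (1 − cos(π/s_i)) ≤ Σ_i (1 − cos(π/s'_i))` for `1 ≤ s'_i ≤ s_i`. -/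
theorem edge_mono {s s' : Fin 4 → ℕ} (h1 : ∀ i, 1 ≤ s' i) (hle : ∀ i, s' i ≤ s i) :
    ∑ i, (1 - Real.cos (Real.pi / s i)) ≤ ∑ i, (1 - Real.cos (Real.pi / s' i)) := by
  refine Finset.sum_le_sum fun i _ => ?_
  have hs'pos : (0 : ℝ) < s' i := by exact_mod_cast h1 i
  have hspos : (0 : ℝ) < s i := by exact_mod_cast lt_of_lt_of_le (h1 i) (hle i)
  have hle' : (s' i : ℝ) ≤ s i := by exact_mod_cast hle i
  have hcos : Real.cos (Real.pi / s' i) ≤ Real.cos (Real.pi / s i) := by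
    apply Real.cos_le_cos_of_nonneg_of_le_pi
    · positivity
    · rw [div_le_iff₀ hs'pos]
      have : (1 : ℝ) ≤ s' i := by exact_mod_cast h1 i
      nlinarith [Real.pi_pos]
    · exact div_le_div_of_nonneg_left Real.pi_pos.le hs'pos hle'
  linarith

/-- An exact eigenvector with eigenvalue `μ' − μ₀`, `|μ' − μ₀| < η`, is an `η`-near-kernel vector. -/
theorem near_of_eigen {ι : Type*} [Fintype ι] {v w : ι → ℂ} (hv : v ≠ 0) {μ₀ μ' η : ℝ}
    (hw : w = ((μ' - μ₀ : ℝ) : ℂ) • v) (hη : |μ' - μ₀| < η) :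
    ∑ p, ‖w p‖ ^ 2 < η ^ 2 * ∑ p, ‖v p‖ ^ 2 := by
  have hsum : ∑ p, ‖w p‖ ^ 2 = |μ' - μ₀| ^ 2 * ∑ p, ‖v p‖ ^ 2 := by
    rw [Finset.mul_sum]
    refine Finset.sum_congr rfl fun p _ => ?_
    rw [hw, Pi.smul_apply, smul_eq_mul, norm_mul, Complex.norm_real, Real.norm_eq_abs]
    ring
  have hpos : 0 < ∑ p, ‖v p‖ ^ 2 := by
    obtain ⟨p, hp⟩ : ∃ p, v p ≠ 0 := Function.ne_iff.mp hv
    exact Finset.sum_pos' (fun q _ => by positivity) ⟨p, Finset.mem_univ _, by positivity⟩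
  have habs : 0 ≤ |μ' - μ₀| := abs_nonneg _
  have hsq : |μ' - μ₀| ^ 2 < η ^ 2 := by
    have hη0 : 0 < η := lt_of_le_of_lt habs hη
    nlinarith
  rw [hsum]
  exact mul_lt_mul_of_pos_right hsq hpos

/-- **The planner's stub 1 (`reverseWegnerSojourn`), now a theorem from stubs 1a–1c.** A sign defect of the box `s`
(`2 ≤ s_i ≤ N`) at scale `j` and valence mass `μ` forces a crossing mass `μ₀ ∈ [μ, −edge(s)]` of the parent or of a
child such that for every `η` and every `μ'` with `|μ' − μ₀| < η` THAT cell has an `η`-near-kernel (its kernel vector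
at `μ₀`). -/
theorem reverseWegnerSojourn :
    ∀ (N : ℕ) [NeZero N] (U : GaugeConfig 4 N (Matrix.specialUnitaryGroup (Fin 3) ℂ)) (μ : ℝ) (j : ℕ)
      (s : Fin 4 → ℕ), (∀ i, 2 ≤ s i) → (∀ i, s i ≤ N) → IsSignDefect U μ j s →
      ∃ μ₀ : ℝ, μ ≤ μ₀ ∧ μ₀ ≤ -∑ i, (1 - Real.cos (Real.pi / s i)) ∧
        ∀ η μ' : ℝ, |μ' - μ₀| < η →
          ((∃ v : {p // wilsonBox (0 : TorusSite 4 N) s p} → ℂ, v ≠ 0 ∧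
              ∑ p, ‖(wilsonCell U μ' 0 s).mulVec v p‖ ^ 2 < η ^ 2 * ∑ p, ‖v p‖ ^ 2) ∨
            ∃ c : Fin 4 → Bool, ∃ v : {p // wilsonBox (halfCorner s c : TorusSite 4 N) (halfSides s c) p} → ℂ,
              v ≠ 0 ∧ ∑ p, ‖(wilsonCell U μ' (halfCorner s c) (halfSides s c)).mulVec v p‖ ^ 2 <
                η ^ 2 * ∑ p, ‖v p‖ ^ 2) := by
  intro N _ U μ j s hs2 hsN hdef
  obtain ⟨μ₀, hμ, hcross⟩ := stub_defectCrossing N U μ j s hdef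
  have hs1 : ∀ i, 1 ≤ s i := fun i => le_trans (by norm_num) (hs2 i)
  rcases hcross with hpar | ⟨c, hch⟩
  · -- the parent crosses at μ₀
    have hedge := stub_kineticEdgeCell stub_boxGroundState N U μ₀ 0 s hsN hpar
    obtain ⟨v, hv, hker⟩ := Matrix.exists_mulVec_eq_zero_iff.mpr hpar
    refine ⟨μ₀, hμ, by linarith, fun η μ' hη => Or.inl ⟨v, hv, ?_⟩⟩
    exact near_of_eigen hv (stub_sojourn N U μ₀ μ' 0 s v hker) hη
  · -- the child `c` crosses at μ₀
    have hsN' : ∀ i, halfSides s c i ≤ N := fun i => le_trans (halfSides_le s c i) (hsN i)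
    have hedge := stub_kineticEdgeCell stub_boxGroundState N U μ₀ (halfCorner s c) (halfSides s c) hsN' hch
    have hmono := edge_mono (s := s) (s' := halfSides s c) (one_le_halfSides s hs2 c) (halfSides_le s c)
    obtain ⟨v, hv, hker⟩ := Matrix.exists_mulVec_eq_zero_iff.mpr hch
    refine ⟨μ₀, hμ, by linarith, fun η μ' hη => Or.inr ⟨c, v, hv, ?_⟩⟩
    exact near_of_eigen hv (stub_sojourn N U μ₀ μ' (halfCorner s c) (halfSides s c) v hker) hη

/-! ## The reduction: the transfer implies the crux -/

/-- **The line's reduction, certified: the transfer `C⁺` implies the crux.** `NegativeCellsDilute` follows from the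
windowed strip law (a⁺) together with the parity pin (b) under one regularisation (the statement of the line's open
stub `stub_pinnedStripLaw`, taken here as the hypothesis `h₃`), by `reverseWegnerSojourn` (landed stubs
`stub_defectCrossing`, `stub_boxGroundState`, `stub_kineticEdgeCell`, `stub_sojourn`) and the reverse Wegner counting
`stub_reverseWegnerCount` (landed): the transfer's witness and pin pass through; at `(ε, k, S)` its `η, δ` serve clause
(a) because the defect event of a window box forces a sojourn and such events are dominated by the strip statistic. -/
theorem negativeCellsDilute_of_pinnedStripLaw
    (h₃ : ∀ Nf : ℕ, (Nf = 2 ∨ Nf = 3) → ∃ reg : QCDRegularisation Nf, reg.HasMassScaling ∧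
        (reg.scheme 0 0 0).HasAsymptoticScaling ∧ ∃ M₀ : ℝ, 0 ≤ M₀ ∧ ∃ b₀ : ℕ, 2 ≤ b₀ ∧ ∃ ℓ : ℝ, 0 < ℓ ∧
        ∀ m : Fin Nf → ℝ, (∀ f, M₀ < m f) → ∃ R : ℝ, 0 < R ∧
        (∀ ε : ℝ, 0 < ε → ∀ᶠ k : ℕ in Filter.atTop, ∀ S : ℕ, R ≤ reg.a k * (2 * S + 1) →
          ∃ η : ℝ, 0 < η ∧ ∃ δ : ℕ → ℝ, (∀ j, 0 ≤ δ j) ∧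
            ∑ j ∈ Finset.range (Nat.log 2 (⌊ℓ / reg.a k⌋₊ / b₀) + 1), δ j ≤ ε ∧
            ∀ j < Nat.log 2 (⌊ℓ / reg.a k⌋₊ / b₀) + 1, ∀ s : Fin 4 → ℕ,
              (∀ i, b₀ * 2 ^ j ≤ s i ∧ s i < b₀ * 2 ^ (j + 2) ∧ s i ≤ 2 * S + 1 ∧ (s i : ℝ) * reg.a k ≤ ℓ) →
              η⁻¹ * ∑ f, (∫⁻ μ' in Set.Icc (reg.mcrit k + reg.a k * m f / reg.Zm k) (η - ∑ i, (1 - Real.cos (Real.pi / s i))),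
                ENNReal.ofReal
                  ((∫ U : GaugeConfig 4 (2 * S + 1) (Matrix.specialUnitaryGroup (Fin 3) ℂ), (if ((∃ v : {p // wilsonBox (0 : TorusSite 4 (2 * S + 1)) s p} → ℂ, v ≠ 0 ∧
                        ∑ p, ‖(wilsonCell U μ' 0 s).mulVec v p‖ ^ 2 < η ^ 2 * ∑ p, ‖v p‖ ^ 2) ∨
                      ∃ c : Fin 4 → Bool, ∃ v : {p // wilsonBox (halfCorner s c : TorusSite 4 (2 * S + 1)) (halfSides s c) p} → ℂ,
                        v ≠ 0 ∧ ∑ p, ‖(wilsonCell U μ' (halfCorner s c) (halfSides s c)).mulVec v p‖ ^ 2 <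
                          η ^ 2 * ∑ p, ‖v p‖ ^ 2) then (1 : ℝ) else 0) *
                        ∏ f, ‖fermionDet (wilsonDirac (fundamentalRep (Fin 3)) U (reg.mcrit k + reg.a k * m f / reg.Zm k) 1)‖ ∂(wilsonMeasure (fundamentalRep (Fin 3)) (reg.β k))) /
                    (∫ U : GaugeConfig 4 (2 * S + 1) (Matrix.specialUnitaryGroup (Fin 3) ℂ),
                        ∏ f, ‖fermionDet (wilsonDirac (fundamentalRep (Fin 3)) U (reg.mcrit k + reg.a k * m f / reg.Zm k) 1)‖ ∂(wilsonMeasure (fundamentalRep (Fin 3)) (reg.β k))))).toReal ≤ δ j) ∧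
        (∀ M : ℝ, M₀ < M → ∀ᶠ k : ℕ in Filter.atTop, ∀ S : ℕ, R ≤ reg.a k * (2 * S + 1) →
          (1 / 4 : ℝ) ≤
            (∫ U : GaugeConfig 4 (2 * S + 1) (Matrix.specialUnitaryGroup (Fin 3) ℂ), (if (fermionDet (wilsonDirac (fundamentalRep (Fin 3)) U (reg.mcrit k - reg.a k * M / reg.Zm k) 1)).re < 0 then (1 : ℝ) else 0) *
                  ∏ f, ‖fermionDet (wilsonDirac (fundamentalRep (Fin 3)) U (reg.mcrit k + reg.a k * m f / reg.Zm k) 1)‖ ∂(wilsonMeasure (fundamentalRep (Fin 3)) (reg.β k))) /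
              (∫ U : GaugeConfig 4 (2 * S + 1) (Matrix.specialUnitaryGroup (Fin 3) ℂ),
                  ∏ f, ‖fermionDet (wilsonDirac (fundamentalRep (Fin 3)) U (reg.mcrit k + reg.a k * m f / reg.Zm k) 1)‖ ∂(wilsonMeasure (fundamentalRep (Fin 3)) (reg.β k))))) :
    NegativeCellsDilute := by
  have h₁ := reverseWegnerSojourn
  have h₂ := stub_reverseWegnerCount
  intro Nf hNf
  obtain ⟨reg, hms, has, M₀, hM₀, b₀, hb₀, ℓ, hℓ, hm⟩ := h₃ Nf hNf
  refine ⟨reg, hms, has, M₀, hM₀, b₀, hb₀, ℓ, hℓ, fun m hmpos => ?_⟩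
  obtain ⟨R, hR, hA, hB⟩ := hm m hmpos
  refine ⟨R, hR, fun ε hε => ?_, hB⟩
  filter_upwards [hA ε hε] with k hk
  intro S hS
  dsimp only
  obtain ⟨η, hη, δ, -, hδε, hbox⟩ := hk S hS
  refine ⟨δ, hδε, fun j hj s hs => ?_⟩
  have hs2 : ∀ i, 2 ≤ s i := fun i =>
    le_trans hb₀ (le_trans (Nat.le_mul_of_pos_right _ (Nat.two_pow_pos j)) (hs i).1)
  have hsN : ∀ i, s i ≤ 2 * S + 1 := fun i => (hs i).2.2.1
  refine le_trans (h₂ (2 * S + 1) (reg.β k) Nf (fun f => reg.mcrit k + reg.a k * m f / reg.Zm k) s η hη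
    (fun U => ∃ f, IsSignDefect U (reg.mcrit k + reg.a k * m f / reg.Zm k) j s) ?_) (hbox j hj s hs)
  rintro U ⟨f, hf⟩
  obtain ⟨μ₀, hμ, hedge, hsoj⟩ := h₁ (2 * S + 1) U _ j s hs2 hsN hf
  exact ⟨f, μ₀, hμ, hedge, fun μ' hμ' => hsoj η μ' hμ'⟩

end Summit.QuantumFields.QCD.Cruxes.NegativeCellsDilute.MassWegnerCellIndex

end
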